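import Mathlib
import Literature.NumberTheory.LFunctions.Zhang2022.Section8cStatements
import HarnessLib

/-!
# Zhang (2022) §8 pp. 47–48: (8.10) and the substitution `n = dr` in `S_j(𝐚₁₁,𝐚₂₁)` — DISCHARGED

Topic `Literature/NumberTheory/LFunctions/Zhang2022` (Landau–Siegel audit tree; verdict-neutral).
Y. Zhang, *Discrete mean estimates and the Landau–Siegel zero*, arXiv:2211.02515v1 (2022)
[Zhang2022LandauSiegel] — **an unrefereed manuscript under adjudication**; D-0069 campaign, cell
`siegel-zhang`, DISCHARGE lane, front end of `Skeleton.Ded823 c′` (nodes `Z22:§8.u045`,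
`Z22:(8.10)`, `Z22:§8.u046`; tex L2443–L2456, PDF pp. 47–48). Theorem-only; the statements are the typed claims
`Section8cStatements.Step8u045`, `Eq810`, `DedStep8u046 c′` (slice L2-t8, p412011), the last one via
a version for arbitrary `x`-profiles `F, G` with the weight `arithW` unfolded (`dedStep8u046_of`).

* `Z22:§8.u045`, `Z22:(8.10)`: the tree PROVES both identities for an arbitrary REAL weight `c(q)`
  (`sum_squarefree_divisors_local`, `sum_squarefree_divisors_PiLocal`, `Section8ArithmeticIdentity`);
  here they are transported to the manuscript's quadratic `χ` (`χ(q) = Re χ(q) ∈ {0, ±1}`,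
  `Skeleton.PiW χ d r = PiLocal (Re χ) d r`, and `Re χ(q) ≠ q` for a prime `q`).
* `Z22:§8.u046` ("It follows, by substituting `n = dr`, that …"): for `n ≥ 1`,
  `Σ_{(d,r): dr = n} |μ(r)χ(dr)|λ₀ⱼ(dr)Π(d,r)/(drφ(r))·F = |χ(n)|λ₀ⱼ(n)n⁻¹F·Σ_{r∣n, r squarefree}Π(n/r,r)/φ(r)
  = |χ(n)|λ₀ⱼ(n)/φ(n)·F` by (8.10); hence the gathering display and the substituted display have
  EQUAL right-hand sides and the deduction `Step8u044 → Eq810 → Step8u046` holds.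

| DAG node | typed claim | theorem | status |
|---|---|---|---|
| `Z22:§8.u045` | `Section8cStatements.Step8u045` | `step8u045_holds` | DISCHARGED |
| `Z22:(8.10)` | `Section8cStatements.Eq810` | `eq810_holds` | DISCHARGED |
| `Z22:§8.u046` | `Section8cStatements.DedStep8u046 c′` | `dedStep8u046_holds` (via `dedStep8u046_of`) | DISCHARGED (deduction) |

WHAT THIS FILE IS NOT: a proof of the gathering display `Z22:§8.u044` itself, of (8.11), or of
anything about Theorems 1–2 / Landau–Siegel zeros. No definition, no new fact.

## References

* Y. Zhang, arXiv:2211.02515v1 (2022), §8 pp. 47–48 (tex L2443–L2456), (8.10), Lemma 8.3 (`Π(d,r)`).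
  [cite: Zhang2022LandauSiegel, §8 pp.47–48]
-/

noncomputable section

open Complex Real ComplexConjugate Finset

namespace Literature.NumberTheory.LFunctions.Zhang2022.Section8FrontEnd810

open Literature.NumberTheory.LFunctions.Zhang2022.Skeleton

/-! ## `Z22:§8.u045` and `Z22:(8.10)` — DISCHARGED from the tree's real-weight identities -/

/-- The values of a quadratic character are real: `χ(q) = Re χ(q)` as a complex number. [folklore] -/
private theorem quadratic_apply_eq_re {D : ℕ} [NeZero D] {χ : DirichletCharacter ℂ D}
    (hq : χ.IsQuadratic) (a : ZMod D) : χ a = ((χ a).re : ℂ) := by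
  rcases hq a with h | h | h <;> simp [h]

/-- `Π(d,r)` of Lemma 8.3 (`Skeleton.PiW`) is the tree's real `PiLocal` at the weight `q ↦ Re χ(q)`,
for a quadratic `χ`. [cite: Zhang2022LandauSiegel, §8 Lemma 8.3 p.46] -/
theorem PiW_eq_PiLocal {D : ℕ} [NeZero D] {χ : DirichletCharacter ℂ D} (hq : χ.IsQuadratic)
    (d r : ℕ) : PiW χ d r = ((PiLocal (fun q => (χ (q : ZMod D)).re) d r : ℝ) : ℂ) := by
  rw [PiW, PiLocal]
  push_cast
  congr 1
  · apply Finset.prod_congr rfl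
    intro q _
    rw [quadratic_apply_eq_re hq (q : ZMod D), Complex.ofReal_re]
    simp only [div_eq_mul_inv]
  · apply Finset.prod_congr rfl
    intro q _
    rw [quadratic_apply_eq_re hq (q : ZMod D), Complex.ofReal_re]
    simp only [div_eq_mul_inv, one_mul]

/-- For a quadratic `χ` and a prime `q`, `Re χ(q) ≠ q` (`|χ(q)| ≤ 1 < 2 ≤ q`). [folklore] -/
private theorem re_apply_ne_of_prime {D : ℕ} [NeZero D] {χ : DirichletCharacter ℂ D} (hq : χ.IsQuadratic)
    {n : ℕ} : ∀ q ∈ n.primeFactors, (fun q : ℕ => (χ (q : ZMod D)).re) q ≠ q := by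
  intro q hq' heq
  have hq2 : (2 : ℝ) ≤ q := by exact_mod_cast (Nat.prime_of_mem_primeFactors hq').two_le
  have h1 : (χ (q : ZMod D)).re ≤ 1 := by
    rcases hq (q : ZMod D) with h | h | h <;> simp [h]
  simp only at heq
  linarith

/-- **`Z22:§8.u045` DISCHARGED** (`Section8cStatements.Step8u045`): "It can be shown, by
verifying the case `n = qᵏ`, that `Σ_{n=dr}|μ(r)|r⁻¹∏_{(q,r)=1,q∣d}(1 − q⁻¹ − χ(q)q⁻¹) = ∏_{q∣n}(1 − χ(q)q⁻¹)`"
— the tree's `sum_squarefree_divisors_local` (real weights) at `c(q) = Re χ(q) = χ(q)`.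
[cite: Zhang2022LandauSiegel, §8 display before (8.10) p.47, tex L2444] -/
theorem step8u045_holds : Section8cStatements.Step8u045 := by
  unfold Section8cStatements.Step8u045
  intro D _ χ hq n hn
  have key := sum_squarefree_divisors_local (fun q => (χ (q : ZMod D)).re) hn
  have e1 : ∀ q : ℕ, (1 - (q : ℂ)⁻¹ - χ (q : ZMod D) * (q : ℂ)⁻¹) =
      ((1 - 1 / (q : ℝ) - (χ (q : ZMod D)).re / q : ℝ) : ℂ) := by
    intro q
    rw [quadratic_apply_eq_re hq (q : ZMod D), Complex.ofReal_re]
    push_cast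
    simp only [div_eq_mul_inv, one_mul]
  have e2 : ∀ q : ℕ, (1 - χ (q : ZMod D) * (q : ℂ)⁻¹) = ((1 - (χ (q : ZMod D)).re / q : ℝ) : ℂ) := by
    intro q
    rw [quadratic_apply_eq_re hq (q : ZMod D), Complex.ofReal_re]
    push_cast
    simp only [div_eq_mul_inv]
  simp_rw [e1, e2]
  have h := congrArg (fun t : ℝ => (t : ℂ)) key
  push_cast at h ⊢
  exact h

/-- `Step8u045` — `_holds` alias of `step8u045_holds` above under the fact's exact name (appended
2026-08-28, D-0026 bookkeeping: the proof term is the existing theorem of this file; no statement,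
definition or attribute is edited; no new named fact; the ledger's debt table listed the fact
unproved). [cite: Zhang2022LandauSiegel, §8 display before (8.10) p.47, tex L2444] -/
theorem _root_.Literature.NumberTheory.LFunctions.Zhang2022.Section8cStatements.Step8u045_holds :
    Section8cStatements.Step8u045 :=
  _root_.Literature.NumberTheory.LFunctions.Zhang2022.Section8FrontEnd810.step8u045_holds

/-- **`Z22:(8.10)` DISCHARGED** (`Section8cStatements.Eq810`): "so that
`Σ_{n=dr}|μ(r)|φ(r)⁻¹Π(d,r) = n/φ(n)` (8.10)" — the tree's `sum_squarefree_divisors_PiLocal` (real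
weights, hypothesis `c(q) ≠ q` automatic for `|χ(q)| ≤ 1`) transported to the skeleton's complex
`Π(d,r)` for the quadratic `χ`. [cite: Zhang2022LandauSiegel, §8 (8.10) p.48, tex L2448] -/
theorem eq810_holds : Section8cStatements.Eq810 := by
  unfold Section8cStatements.Eq810
  intro D _ χ hq n hn
  have key := sum_squarefree_divisors_PiLocal (fun q => (χ (q : ZMod D)).re) hn
    (re_apply_ne_of_prime hq)
  simp_rw [PiW_eq_PiLocal hq]
  have h := congrArg (fun t : ℝ => (t : ℂ)) key
  push_cast at h ⊢
  exact h

/-- `Eq810` — `_holds` alias of `eq810_holds` above under the fact's exact name (appended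
2026-08-28, D-0026 bookkeeping: the proof term is the existing theorem of this file; no statement,
definition or attribute is edited; no new named fact; the ledger's debt table listed the fact
unproved). [cite: Zhang2022LandauSiegel, §8 (8.10) p.48, tex L2448] -/
theorem _root_.Literature.NumberTheory.LFunctions.Zhang2022.Section8cStatements.Eq810_holds :
    Section8cStatements.Eq810 :=
  _root_.Literature.NumberTheory.LFunctions.Zhang2022.Section8FrontEnd810.eq810_holds

/-! ## `Z22:§8.u046`: the substitution `n = dr` — the deduction `DedStep8u046` DISCHARGED -/

/-- The regrouping behind "substituting `n = dr`" (p. 48): for `n ≥ 1`,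
`Σ_{(d,r): dr=n} |μ(r)χ(dr)|λ₀ⱼ(dr)Π(d,r)/(drφ(r)) · F = |χ(n)|λ₀ⱼ(n)/φ(n) · F`, by (8.10)
(`Σ_{dr=n}|μ(r)|Π(d,r)/φ(r) = n/φ(n)`, taken as a hypothesis in the shape of `Eq810`).
[cite: Zhang2022LandauSiegel, §8 display after (8.10) p.48, tex L2451] -/
theorem sum_antidiagonal_weight {D : ℕ} [NeZero D] (χ : DirichletCharacter ℂ D) (c' : ℝ) (j : ℕ)
    (h810 : ∀ n : ℕ, n ≠ 0 →
      ∑ r ∈ n.divisors with Squarefree r, (1 / (Nat.totient r : ℂ)) * PiW χ (n / r) r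
        = (n : ℂ) / (Nat.totient n : ℂ))
    {n : ℕ} (hn : n ≠ 0) (F : ℂ) :
    ∑ p ∈ Nat.divisorsAntidiagonal n,
        ((ArithmeticFunction.moebius p.2).natAbs : ℂ) * (‖χ ((p.1 * p.2 : ℕ) : ZMod D)‖ : ℂ) /
            (((p.1 * p.2 : ℕ) : ℂ) * (Nat.totient p.2 : ℂ)) *
          lamZero c' D j (p.1 * p.2) * PiW χ p.1 p.2 * F =
      (‖χ (n : ZMod D)‖ : ℂ) * lamZero c' D j n / (Nat.totient n : ℂ) * F := by
  have step1 : ∀ p ∈ Nat.divisorsAntidiagonal n,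
      ((ArithmeticFunction.moebius p.2).natAbs : ℂ) * (‖χ ((p.1 * p.2 : ℕ) : ZMod D)‖ : ℂ) /
            (((p.1 * p.2 : ℕ) : ℂ) * (Nat.totient p.2 : ℂ)) *
          lamZero c' D j (p.1 * p.2) * PiW χ p.1 p.2 * F =
        ((‖χ (n : ZMod D)‖ : ℂ) * lamZero c' D j n / (n : ℂ) * F) *
          (((ArithmeticFunction.moebius p.2).natAbs : ℂ) / (Nat.totient p.2 : ℂ) * PiW χ p.1 p.2) := by
    intro p hp
    rw [Nat.mem_divisorsAntidiagonal] at hp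
    rw [hp.1]
    ring
  rw [Finset.sum_congr rfl step1, ← Finset.mul_sum,
    show (∑ p ∈ Nat.divisorsAntidiagonal n,
        ((ArithmeticFunction.moebius p.2).natAbs : ℂ) / (Nat.totient p.2 : ℂ) * PiW χ p.1 p.2) =
      ∑ r ∈ n.divisors, ((ArithmeticFunction.moebius r).natAbs : ℂ) / (Nat.totient r : ℂ) *
        PiW χ (n / r) r from
      Nat.sum_divisorsAntidiagonal' (fun a b =>
        ((ArithmeticFunction.moebius b).natAbs : ℂ) / (Nat.totient b : ℂ) * PiW χ a b)]
  have step2 : ∑ r ∈ n.divisors, ((ArithmeticFunction.moebius r).natAbs : ℂ) /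
        (Nat.totient r : ℂ) * PiW χ (n / r) r =
      ∑ r ∈ n.divisors with Squarefree r, (1 / (Nat.totient r : ℂ)) * PiW χ (n / r) r := by
    rw [Finset.sum_filter]
    apply Finset.sum_congr rfl
    intro r _
    by_cases hsq : Squarefree r
    · rw [if_pos hsq]
      have : (ArithmeticFunction.moebius r).natAbs = 1 := by
        rw [← Int.natAbs_abs, ArithmeticFunction.abs_moebius_eq_one_of_squarefree hsq]; rfl
      rw [this]; push_cast; ring
    · rw [if_neg hsq, ArithmeticFunction.moebius_eq_zero_of_not_squarefree hsq]; simp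
  rw [step2, h810 n hn]
  have hn0 : (n : ℂ) ≠ 0 := by exact_mod_cast hn
  have hφ : (Nat.totient n : ℂ) ≠ 0 := by exact_mod_cast (Nat.totient_pos.mpr (Nat.pos_of_ne_zero hn)).ne'
  field_simp

/-- The deduction "It follows, by substituting `n = dr`, that …" for ARBITRARY profiles `F` (in the
typed display: `mFac·nFac`) and `G` (`diagFac`) in place of the two `x`-profiles, with the arithmetic
weight `arithW` unfolded: the two displayed right-hand sides are EQUAL, by `sum_antidiagonal_weight`
under each `Σ_n`. [cite: Zhang2022LandauSiegel, §8 display after (8.10) p.48, tex L2451] -/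
theorem dedStep8u046_of (c' : ℝ) (F G : ℕ → ℕ → ℕ → ℂ)
    (h44 : ∀ ε : ℝ, 0 < ε → ForAllLarge fun D _ χ => AssumptionA D χ →
      ∀ j ∈ ({1, 2, 3} : Finset ℕ),
        ‖Sj c' D j (a11 χ) (a21 χ) -
            (deriv χ.LFunction 1 ^ 2 *
                (∑ n ∈ Finset.Ico 1 ⌈Skeleton.P2 D⌉₊, ∑ p ∈ Nat.divisorsAntidiagonal n,
                  ((ArithmeticFunction.moebius p.2).natAbs : ℂ) *
                        (‖χ ((p.1 * p.2 : ℕ) : ZMod D)‖ : ℂ) /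
                      (((p.1 * p.2 : ℕ) : ℂ) * (Nat.totient p.2 : ℂ)) *
                    lamZero c' D j (p.1 * p.2) * PiW χ p.1 p.2 * F D j n) +
              deriv χ.LFunction 1 ^ 2 *
                (∑ n ∈ Finset.Ico ⌈Skeleton.P2 D⌉₊ ⌈Skeleton.P1 D⌉₊, ∑ p ∈ Nat.divisorsAntidiagonal n,
                  ((ArithmeticFunction.moebius p.2).natAbs : ℂ) *
                        (‖χ ((p.1 * p.2 : ℕ) : ZMod D)‖ : ℂ) /
                      (((p.1 * p.2 : ℕ) : ℂ) * (Nat.totient p.2 : ℂ)) *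
                    lamZero c' D j (p.1 * p.2) * PiW χ p.1 p.2 * G D j n))‖
          ≤ ε * alpha D)
    (h810 : ∀ (D : ℕ) [NeZero D] (χ : DirichletCharacter ℂ D), χ.IsQuadratic → ∀ n : ℕ, n ≠ 0 →
      ∑ r ∈ n.divisors with Squarefree r, (1 / (Nat.totient r : ℂ)) * PiW χ (n / r) r
        = (n : ℂ) / (Nat.totient n : ℂ)) :
    ∀ ε : ℝ, 0 < ε → ForAllLarge fun D _ χ => AssumptionA D χ →
      ∀ j ∈ ({1, 2, 3} : Finset ℕ),
        ‖Sj c' D j (a11 χ) (a21 χ) -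
            (deriv χ.LFunction 1 ^ 2 *
                (∑ n ∈ Finset.Ico 1 ⌈Skeleton.P2 D⌉₊,
                  (‖χ (n : ZMod D)‖ : ℂ) * lamZero c' D j n / (Nat.totient n : ℂ) * F D j n) +
              deriv χ.LFunction 1 ^ 2 *
                (∑ n ∈ Finset.Ico ⌈Skeleton.P2 D⌉₊ ⌈Skeleton.P1 D⌉₊,
                  (‖χ (n : ZMod D)‖ : ℂ) * lamZero c' D j n / (Nat.totient n : ℂ) * G D j n))‖
          ≤ ε * alpha D := by
  intro ε hε
  refine (h44 ε hε).mono ?_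
  intro D _ χ hq _ h hA j hj
  have key := h hA j hj
  have hP2 : 0 < Skeleton.P2 D :=
    div_pos (Real.rpow_pos_of_pos (Real.exp_pos _) _) (pow_pos (Real.exp_pos _) _)
  have h1 : ∀ n ∈ Finset.Ico 1 ⌈Skeleton.P2 D⌉₊, n ≠ 0 := fun n hn => by
    rw [Finset.mem_Ico] at hn; omega
  have h2 : ∀ n ∈ Finset.Ico ⌈Skeleton.P2 D⌉₊ ⌈Skeleton.P1 D⌉₊, n ≠ 0 := fun n hn => by
    rw [Finset.mem_Ico] at hn
    have : 0 < ⌈Skeleton.P2 D⌉₊ := Nat.ceil_pos.mpr hP2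
    omega
  rw [Finset.sum_congr rfl (fun n hn =>
      sum_antidiagonal_weight χ c' j (h810 D χ hq) (h1 n hn) (F D j n)),
    Finset.sum_congr rfl (fun n hn =>
      sum_antidiagonal_weight χ c' j (h810 D χ hq) (h2 n hn) (G D j n))] at key
  exact key


/-- **`Z22:§8.u046` DEDUCTION DISCHARGED**: `Section8cStatements.DedStep8u046 c′`
(`Step8u044 c′ → Eq810 → Step8u046 c′`, "It follows, by substituting `n = dr`, that …") holds — the
instance `F = mFac·nFac`, `G = diagFac` of `dedStep8u046_of`.
[cite: Zhang2022LandauSiegel, §8 display after (8.10) p.48, tex L2451] -/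
theorem dedStep8u046_holds (c' : ℝ) : Section8cStatements.DedStep8u046 c' := by
  intro h44 h810
  exact dedStep8u046_of c'
    (fun D j n => Section8cStatements.mFac c' D j n * Section8cStatements.nFac c' D j n)
    (fun D j n => Section8cStatements.diagFac c' D j n) h44 h810

variable (c' : ℝ) in
/-- `DedStep8u046` — `_holds` alias of `dedStep8u046_holds` above under the fact's exact name, stated under the
prover's own binders as section variables (appended 2026-08-28, D-0026 bookkeeping: the proof term is the
existing theorem of this file; no statement, definition or attribute is edited; no new named fact; the
ledger's debt table listed the fact unproved). [cite: Zhang2022LandauSiegel, §8 display after (8.10) p.48, tex L2451] -/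
theorem _root_.Literature.NumberTheory.LFunctions.Zhang2022.Section8cStatements.DedStep8u046_holds :
    _root_.Literature.NumberTheory.LFunctions.Zhang2022.Section8cStatements.DedStep8u046 c' :=
  _root_.Literature.NumberTheory.LFunctions.Zhang2022.Section8FrontEnd810.dedStep8u046_holds (c' := c')

end Literature.NumberTheory.LFunctions.Zhang2022.Section8FrontEnd810
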